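import Literature.MathematicalPhysics.QuantumFieldTheory.Balaban1983to89.B8SockHFPCubeMember
import Literature.MathematicalPhysics.QuantumFieldTheory.Balaban1983to89.B8DentedCubeMemberLamBPrime

/-!
# `Balaban1983to89.B8SockHFPDentedCubeMember` — [Balaban1985RegularSpaces] (1.68) p. 88 ∕ (1.5)–(1.6) p. 77 ON THE DENTED TOWER OF [Balaban1985Variational] (148)–(150): THE THREE
# MEMBER LAWS `htw ∕ h8lt ∕ h8top` OF THE PROP.-5 SERVERS (`B8SockHFPOfSockLetters`, `B8SockHFP59Gamma`) FOR THE DENTED TRUNCATED CELLS `CubeB8D.lamST` — twin of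
# `B8SockHFPCubeMember` §1 ((d3) MAP item (2), laws half)

statement-level skeleton of published theorems with citation tags; proofs where landed; nothing here is a claim about the
Yang–Mills mass gap

`[Balaban1985RegularSpaces]` ("B8" = [6], CMP **99** (1985) 75–102) (1.68) p. 88 («taking Λ_{k−1} ∪ B(Λ_k) as Λ_{k−1}»), (1.5)–(1.6) p. 77, p. 98, (1.131) p. 99; `[Balaban1985Variational]`
("[15]", CMP **102** (1985) 277–309) (148)–(150) p. 301.  PDF held: `paper:balaban1985-cmp99-regular-spaces-gauge-fixing`, `paper:balaban1985-cmp102-variational-background`.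

CITATION HEADER (lean-in-tree rule).  Cell `pub-ymgap` (D-0062), DAG node N05 = [B8], seat `pub-ymgap-dag-n05-e` (g31; FAN-OUT §N05 row s3b, (β) road; dag-n05-c standing GO on dented
twins I.42366).  WHY THIS FILE.  The Prop.-5 fixed-point servers of the N05 lineage (n05-d's `B8SockHFPOfSockLetters.exists_threshold_sockHFP_pair`, this seat's
`B8SockHFP59Gamma.sockHFP_body_of_join_59_γ`, consumed by Fγ5 `B8Prop6CubeMemberFlatScalarGamma`) display three MEMBER LAWS on the truncated cells `Λs m j`: `htw` (towers of every
truncation lie in `Ω_j`), `h8lt` (below the truncation level the truncations at `m` and `m + 1` agree), `h8top` ((1.68): `Ω_m^{(m)} = Λ_m ∪ B(Λ_{m+1})` read between the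
truncations `m` and `m + 1`); `B8SockHFPCubeMember` §1 proves them for the PURE cube member.  THIS FILE proves them for the DENTED truncated cells `c.lamST` of NODE 00's `CubeB8D`
(p655171 ∕ `B8DentedCubeMemberZd`).  Below the top everything is the pure member's; the one new step is `h8top` between the truncations `k − 1` and `k`: `□_{k−1}^{(k−1)} =
Λ′_{k−1} ∪ B(Λ′_k)` with the ENLARGED `Λ′_{k−1}` — a `(k−1)`-site of `□_k^{(k−1)}` either has its `k`-parent's block inside `Ω_k` (then it lies under a cell of `Λ′_k`) or not
(then it IS a cell of `Λ′_{k−1}`, `B8DentedCubeMemberLamBPrime.block_mem_lamS_pred_of_not_inTop`).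

WHAT THIS MODULE PROVES (kernel, 0 sorry; `c : Node00.CubeB8D d L K Ω`, `1 ≤ L`): ★ `htw_lamST`, `h8lt_lamST`, ★ `h8top_lamST` — VERBATIM the `htw ∕ h8lt ∕ h8top` binders of
`exists_threshold_sockHFP_pair` ∕ `sockHFP_body_of_join_59_γ` at `(Ω, Λs) := (c.sq, c.lamST)`.
HONEST SCOPE.  Set algebra on the dented tower; no estimate; the sockets themselves (§2 of the pure file) are not twinned here.  Count-neutral; N05 ∕ N07 NOT discharged; one finite `T⁴`
programme at fixed `ε`, Bałaban as printed; nothing continuum ∕ ℝ⁴ ∕ OS ∕ mass-gap ∕ Clay.  No `sorry`, no `def`, no `instance`, no `notation`.  Unit `pub-ymgap-dag-n05-e` (g31),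
2026-08-28.

RELATED IN THE TREE, NOT DUPLICATED: `B8SockHFPCubeMember.{htw_cubeLamS, h8lt_cubeLamS, h8top_cubeLamS}` (dag-n05-c; PURE member — USED), `B8DentedCubeMemberZd.{lamST_of_lt, lamST_top,
htower_lamS, inBox_sq_of_mem_lamS}` (g31), `B8DentedCubeMemberLamBPrime.{cubeLam_subset_lamS, block_mem_lamS_pred_of_not_inTop}` (g31), `Node00.CarriersB8CubeDented` (p655171).
-/

noncomputable section

namespace Literature.MathematicalPhysics.QuantumFieldTheory.Balaban1983to89.B8SockHFPDentedCubeMember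

open B7Prop1Explicit B7Prop1Local B8Ineq130
open B8Ineq132 (Under)
open B8Thm2LogB (blockTop)
open B8Thm4TruncationLocal (under_one_of_mem_blockSites mem_blockSites_of_under_one)
open B8Eq131Cubes (cube sqLo sqHi inLo inHi flm under_flm mem_cube_iff)
open B8Eq131CubesAdmissible (cubeFam cubeFam_false_of_le)
open B8CubeMemberZd (cubeLam cubeLamS cubeLamS_of_lt cubeLamS_self cubeLamS_top inBox_sq_of_mem_cubeLamS inBox_tower_iff_under)
open B8SockHFPCubeMember (htw_cubeLamS h8lt_cubeLamS h8top_cubeLamS)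
open B8Eq191FlatLettersCubeMember (under_iff_blockMap_eq blockMap_pow_eq_flm flm_one_flm)
open B8DentedCubeMemberZd (lamST_of_lt lamST_top htower_lamS inBox_sq_of_mem_lamS)
open B8DentedCubeMemberLamBPrime (cubeLam_subset_lamS block_mem_lamS_pred_of_not_inTop)
open QuantumLattice (blockSites)
open Node00 (CubeB8D)
open Literature.MathematicalPhysics.QuantumLattice (blockMap)

export B7Prop1Explicit (Site)

variable {d : ℕ} {L K : ℕ} {Ω : ℕ → Set (Site d)} (c : CubeB8D d L K Ω)

/-- ★ **Towers of EVERY truncation of the dented member lie in the dented tower** (`htw`): for `j ≤ m ≤ k` and `y ∈ c.lamST m j ⊂ □_j^{(j)}`, the level-`j` tower `Bʲ(y)` lies in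
`Ω′_j = c.sq j` (below the top `Ω′_j = □_j`; at the top `B8DentedCubeMemberZd.htower_lamS`). [cite: Balaban1985RegularSpaces, p.98, (1.5)–(1.6) p.77; Balaban1985Variational, (148)–(150) p.301] -/
theorem htw_lamST (hL : 1 ≤ L) :
    ∀ m, m ≤ c.k → ∀ j, j ≤ m → ∀ y ∈ c.lamST m j, ∀ x, InBox (tlo L y j) (thi L y j) x → x ∈ c.sq j := by
  intro m hm j hj y hy x hx
  rcases lt_or_eq_of_le hm with hlt | heq
  · rw [lamST_of_lt c hlt] at hy
    rw [c.sq_of_lt (lt_of_le_of_lt hj hlt), ← cubeFam_false_of_le L c.a c.M c.ρ (hj.trans hm)]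
    exact htw_cubeLamS hL c.a c.M c.ρ c.k m hm j hj y hy x hx
  · subst heq
    exact htower_lamS c hL j hj y hy x hx

/-- **The truncation law below the truncation level** (`h8lt`) for the dented member: for `j < m < k` the cells of the truncations at `m` and `m + 1` agree (both are [6]'s `Λ_j`;
at `m + 1 = k` because `j ≤ k − 2`, where the dented cell is the pure one). [cite: Balaban1985RegularSpaces, (1.68) p.88; Balaban1985Variational, (150) p.301] -/
theorem h8lt_lamST : ∀ m, m < c.k → ∀ j, j < m → c.lamST m j = c.lamST (m + 1) j := by
  intro m hm j hj
  rw [lamST_of_lt c hm]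
  rcases Nat.lt_or_ge (m + 1) c.k with hlt | hge
  · rw [lamST_of_lt c hlt]; exact h8lt_cubeLamS L c.a c.M c.ρ c.k m hm j hj
  · have hmk : m + 1 = c.k := by omega
    rw [hmk, lamST_top c, cubeLamS_of_lt L c.a c.M c.ρ c.k hj, c.lamS_of_succ_lt (by omega)]

/-- ★ **The truncation law AT the truncation level** (`h8top`; (1.68) «taking Λ_{k−1} ∪ B(Λ_k) as Λ_{k−1}» between the truncations `m` and `m + 1`) for the dented member: below the top
the pure law; between `k − 1` and `k`: `□_{k−1}^{(k−1)} = Λ′_{k−1} ∪ B(Λ′_k)` — a `(k−1)`-site `x` of `□_{k−1}^{(k−1)}` is a pure cell of `Λ_{k−1} ⊆ Λ′_{k−1}` or lies under a site `y`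
of `□_k^{(k)}`; in the latter case either `y`'s `k`-block lies in `Ω_k` (`y ∈ Λ′_k`) or not — and then `x ∈ Λ′_{k−1}` (the dent, `block_mem_lamS_pred_of_not_inTop`); conversely
`Λ′_{k−1} ⊆ □_{k−1}^{(k−1)}` and `B(Λ′_k) ⊆ B(□_k^{(k)}) ⊆ □_{k−1}^{(k−1)}`. [cite: Balaban1985RegularSpaces, (1.68) p.88, (1.6) p.77, (1.131) p.99; Balaban1985Variational, (148)–(150) p.301] -/
theorem h8top_lamST (hL : 1 ≤ L) :
    ∀ m, m < c.k → ∀ x, x ∈ c.lamST m m ↔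
      x ∈ c.lamST (m + 1) m ∨ ∃ y ∈ c.lamST (m + 1) (m + 1), x ∈ blockSites L y := by
  intro m hmk x
  have hpure := h8top_cubeLamS hL c.a c.M c.ρ c.k m hmk x
  rw [lamST_of_lt c hmk]
  rcases Nat.lt_or_ge (m + 1) c.k with hlt | hge
  · rw [lamST_of_lt c hlt]; exact hpure
  · have hm1 : m + 1 = c.k := by omega
    rw [hm1, lamST_top c]
    have hm : m = c.k - 1 := by omega
    constructor
    · intro hx
      rcases hpure.1 hx with h | ⟨y, hy, hxy⟩
      · -- a pure cell of `Λ_m ⊆ Λ′_m`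
        rw [cubeLamS_of_lt L c.a c.M c.ρ c.k (Nat.lt_succ_self m)] at h
        exact Or.inl (cubeLam_subset_lamS c hmk h)
      · -- under a site `y` of `□_k^{(k)}`
        rw [hm1, cubeLamS_self] at hy
        by_cases htop : c.inTop y
        · exact Or.inr ⟨y, (c.mem_lamS_top_iff y).2 ⟨hy, htop⟩, hxy⟩
        · -- the dent: `x ∈ Λ′_{k−1}`
          left
          have hU : Under L 1 y x := under_one_of_mem_blockSites hxy
          have hx1 : (L : ℤ) • y ≤ x := fun i => by
            have h := (hU i).1; rw [pow_one] at h; simpa [Pi.smul_apply, smul_eq_mul] using h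
          have hx2 : x ≤ (L : ℤ) • y + blockTop L := fun i => by
            have h := (hU i).2; rw [pow_one] at h
            simp only [Pi.add_apply, Pi.smul_apply, smul_eq_mul, blockTop]
            linarith
          subst hm
          exact block_mem_lamS_pred_of_not_inTop c hL hy htop x hx1 hx2
    · rintro (hx | ⟨y, hy, hxy⟩)
      · -- `Λ′_{k−1} ⊆ □_{k−1}^{(k−1)}`
        rw [cubeLamS_self]
        subst hm
        exact inBox_sq_of_mem_lamS c hx
      · -- `B(Λ′_k) ⊆ B(□_k^{(k)}) ⊆ □_{k−1}^{(k−1)}` by the pure law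
        refine hpure.2 (Or.inr ⟨y, ?_, hxy⟩)
        rw [hm1]
        exact c.lamS_top_subset hy

end Literature.MathematicalPhysics.QuantumFieldTheory.Balaban1983to89.B8SockHFPDentedCubeMember

end
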